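/-
COR-CM (cells pub-hodgecm / pub-hodgecm2) — HM-EQUALITY Δ2 / X3, row X3-Char item (F) TREE SIDE, generic half over the ported
package (port layers ≤ 47).  Origin: seat `prover-pub-hodgecm-own-htheta-g8-0` (own-htheta gen 8; X3 co-owner; draft gen 7),
2026-08-23.  Theorems only: no definition, no instance, no named fact, no proof holes; nothing landed is edited or restated.
FRAMING: HC_CM is NOT proved; no COR-CM binder or pin is discharged; «Δ2 BRIDGE CLOSED» is NOT claimed; `h418` is NOT discharged.
-/
import Summits.HodgeConjecture.HodgeCM.Model.LiuDictionaryInstance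
import Literature.NumberTheory.GelbartRogawski1991.UnitaryDualPairWeilCoinvariantsTwistVanishingComp
import HarnessLib

set_option autoImplicit false

noncomputable section

/-!
# The `μ`-block of a Weil-coinvariant Liu dictionary VANISHES at lines with non-smooth finite Weil representation

Objects (ported package, namespaces `HodgeCM.*`): a hermitian 3-space `V : HodgeCM.HermSpace3 L ι₁`; the Betti tower
`Tower … V = colim_K H¹(X_K(ℂ); ℂ)` with its `U(V)(𝔸_{L⁺,f})`-action `towerRep` (`Model/TowerCarrier`) and `ℂ[U(V)(𝔸_f)]`-module
structure (`Model/TowerAlgebra`); split lines `p : SplitLine JV TV …` (a hermitian line `(JW, TW)` with a COMPATIBLE pair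
splitting `p.s`, `p.hs`, NO continuity — `Model/LiuDictionaryInstance`) and their Weil central coinvariants
`p.Ω ιV χ = Representation.asModule ((HodgeCM.WeilCoinv.weilCoinv … χ p.hs).comp ιV)` through a pullback hom
`ιV : ↥V.adelicFin →* U(JV)(𝔸_f)`; Liu–Albanese module data `D` (`Literature/AlbaneseUnitaryShimuraModules`: `block`,
`Thm418Combined`), Liu dictionaries `T` (`Model/LiuDictionary`: `Thm418C`) and the tower dictionaries
`LiuDictionary.ofTower … V Char Adm Ω PhiMu adm` (`Model/LiuDictionaryTower`).
* §0 datum level: `block μ = ⊥` iff every `ℂ[G]`-map `ω(μ,a) → H` vanishes; the [Liu21, Thm 4.18] clause is vacuous at a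
  character with zero block; `Thm418Combined` follows from its clause at the characters with non-zero block.
* §1 `tower_smooth`: the tower is a SMOOTH `U(V)(𝔸_f)`-module (classes come from finite level, `TowerCarrier.exists_ofLevel`;
  `H_K` is `K`-fixed, `towerRep_ofLevel_of_mem`, `Level.isOpen_K`).
* §2 **`linearMap_asModule_eq_zero_of_not_smooth_comp`** — the `ℂ[G]`-module form of the Literature dichotomy
  `WeilCoinv.linearMap_eq_zero_of_not_smooth_comp` ([GR91, §3.1 Remark p. 457] + [BZ76, §2.1]): for a datum carrying a
  [GR91, Prop 3.1.1] compatible continuous splitting (`hGR`), ANY compatible splitting `s`, a CONTINUOUS `ι : G →* U(J_V)(𝔸_f)` and a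
  character `χ` of `U(J_W)(𝔸_f)` with OPEN KERNEL: if `ω_f ∘ s_pair` is NOT smooth (its `U(J_V)`-member through `ι`, or its
  `U(J_W)`-member), every `ℂ[G]`-linear map `(weilCoinv χ hs ∘ ι).asModule → N` into a SMOOTH `ℂ[G]`-module `N` is `0`.
* §3 abstract dictionaries: **`block_eq_bot_of_not_smooth`** — `block μ = ⊥` for a datum with smooth `H` whose `ω(μ, a)` are
  `ℂ[G]`-linear quotients of such Weil modules; **`thm418C_of_smooth`** — for a Liu dictionary `T` with smooth `H` whose
  oscillator modules are quotients of the Weil modules of a family of split lines `line : T.Char → SplitLine …`, the reading r8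
  `T.Thm418C` ([Liu21, Thm. 4.18] combined) FOLLOWS from its clause at the characters whose line has SMOOTH finite Weil
  representation.
* §4 the tower dictionaries `LiuDictionary.ofTower … (fun i a => (line i).Ω ιV (χof i a)) …` (smooth `H`, §1; `eΩ := id` — the ported
  copy `HodgeCM.WeilCoinv.weilCoinv` under `SplitLine.Ω` IS the Literature `weilCoinv`, definitionally): **`block_ofTower_eq_bot_of_not_smooth`**, **`thm418C_ofTower_of_smooth`**.
Use (pin level, after the port of `Model/LiuDictionaryPin`, layer 67: `liuDictionaryPin … V I line = ofTower … I
(fun i => {χ // (line i).IsAutChar χ}) (fun i a => (line i).Ω (ιVE V) a.1) …`): narrows the displayed cite `h418` of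
`CorCM/PortJoin/Closed.lean` ∕ the Δ2 bridge to the smooth-ω index lines — the only ones at which [Liu21]'s objects `ω(μ, ε, χ)`
(Def. 4.11: smooth, irreducible admissible) exist.  Nothing here discharges `h418`; HC_CM is NOT proved.
-/

namespace Summit.HodgeConjecture.CorCM.Transposition.BlockVanishing

open NumberField
open Literature.AlgebraicGeometry.HodgeTheory Literature.NumberTheory.Automorphic.PicardCM
open Literature.NumberTheory.Automorphic Literature.NumberTheory.Weil1964
open Literature.NumberTheory.GelbartRogawski1991 Literature.NumberTheory.GelbartRogawski1991.UnitaryDualPair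
open Literature.NumberTheory.Transcendental (Arapura2012_Cor_15_4_6)
open HodgeCM HodgeCM.Model HodgeCM.Model.TowerCarrier
open HodgeCM.Literature.Theta HodgeCM.Literature.Theta.LiuAlbaneseModuleDatum

/-! ### §0. Datum-level trivialities (`Literature/AlbaneseUnitaryShimuraModules`) -/

section Datum

universe u v w

variable {G : Type u} [Group G] {Lvl : Type v} {Kof : Lvl → Subgroup G} {D : LiuAlbaneseModuleDatum G Kof}

/-- `block μ = ⊥` as soon as every `ℂ[G]`-linear map `ω(μ, a) → H` is zero. [folklore] -/
theorem block_eq_bot {μ : D.Char} (h : ∀ (a : D.Adm μ) (ψ : D.Ωt ⟨μ, a⟩ →ₗ[MonoidAlgebra ℂ G] D.H), ψ = 0) :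
    D.block μ = ⊥ :=
  le_bot_iff.1 (block_le fun a ψ => by rw [h a ψ, LinearMap.range_zero, Submodule.restrictScalars_bot])

/-- **The [Liu2021, Thm. 4.18] clause is VACUOUS at a character with zero block.** [folklore] -/
theorem thm418Combined_clause_of_block_eq_bot [Preorder Lvl] {W : Lvl → Type w} [∀ K, AddCommGroup (W K)]
    [∀ K, Module ℂ (W K)] (res : ∀ K : Lvl, D.H →ₗ[ℂ] W K) (cmCl : ∀ K : Lvl, D.Char → Set (W K)) {μ : D.Char}
    (hμ : D.block μ = ⊥) (K₀ : Lvl) :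
    ∀ K ≤ K₀, ∀ x ∈ D.block μ, x ∈ fixedBy (Kof K) D.H → res K x ∈ Submodule.span ℂ (cmCl K μ) := by
  intro K _ x hx _
  rw [hμ, Submodule.mem_bot] at hx
  rw [hx, map_zero]
  exact Submodule.zero_mem _

/-- **`Thm418Combined` from its clause at the characters with NON-ZERO block only.**
[cite: Liu2021, Thm. 4.18 (FJcycle.tex l. 2232–2245)] -/
theorem thm418Combined_of_ne_bot [Preorder Lvl] [Nonempty Lvl] {W : Lvl → Type w} [∀ K, AddCommGroup (W K)]
    [∀ K, Module ℂ (W K)] (res : ∀ K : Lvl, D.H →ₗ[ℂ] W K) (cmCl : ∀ K : Lvl, D.Char → Set (W K))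
    (h : ∀ μ : D.Char, D.PhiMu μ → D.block μ ≠ ⊥ → ∃ K₀ : Lvl, ∀ K ≤ K₀, ∀ x ∈ D.block μ,
      x ∈ fixedBy (Kof K) D.H → res K x ∈ Submodule.span ℂ (cmCl K μ)) :
    D.Thm418Combined res cmCl := by
  intro μ hΦ
  by_cases hμ : D.block μ = ⊥
  · exact ⟨Classical.arbitrary Lvl, thm418Combined_clause_of_block_eq_bot res cmCl hμ _⟩
  · exact h μ hΦ hμ

end Datum

/-! ### §1. The Betti tower is a smooth `U(V)(𝔸_{L⁺,f})`-module -/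

section Tower

variable {L : CMField} {ι₁ : (L : Type) →+* ℂ}

/-- **every tower class is fixed by an open subgroup** (`Γ.K` for a level `Γ` it comes from). [folklore] -/
theorem tower_smooth (hHD : exists_isReal_hodgeModel) (hI : hodgePQ_independent_of_hodgeModel)
    (hU : BallQuotientUniformisedDatum) (h₃ : CMAbelianVarietyRealised) (hA : Arapura2012_Cor_15_4_6) (V : HermSpace3 L ι₁)
    (y : Tower hHD hI hU h₃ hA V) :
    ∃ K : Subgroup ↥V.adelicFin, IsOpen (K : Set ↥V.adelicFin) ∧ ∀ g ∈ K, towerRep hHD hI hU h₃ hA V g y = y := by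
  obtain ⟨Γ, hΓ, cf, rfl⟩ := exists_ofLevel hHD hI hU h₃ hA y
  exact ⟨Γ.K, Γ.isOpen_K, fun g hg => towerRep_ofLevel_of_mem hHD hI hU h₃ hA hΓ hg cf⟩

end Tower

/-! ### §2. Every `ℂ[G]`-linear map out of the Weil coinvariants into a smooth module vanishes when `ω_f ∘ s_pair` is not
smooth — the `Representation.asModule` form of the Literature dichotomy, and its instance at a split line and the tower -/

section AsModule

variable {G : Type*} [Group G]

/-- in `ρ.asModule`, the group element `g` (as `MonoidAlgebra.of ℂ G g`) acts by `ρ g`. [folklore] -/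
theorem of_smul_asModule {M : Type*} [AddCommGroup M] [Module ℂ M] (ρ : Representation ℂ G M) (g : G) (x : ρ.asModule) :
    MonoidAlgebra.of ℂ G g • x = ρ g (ρ.asModuleEquiv x) := by
  have h := ρ.asModuleEquiv_map_smul (MonoidAlgebra.of ℂ G g) x
  rwa [Representation.asAlgebraHom_of] at h

/-- **a `ℂ[G]`-linear map out of the module of a representation intertwines it with `g ↦ (of g • ·)`** (on the
underlying `ℂ`-spaces). [folklore] -/
theorem restrictScalars_apply_rho {M N : Type*} [AddCommGroup M] [Module ℂ M] [AddCommGroup N] [Module ℂ N]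
    [Module (MonoidAlgebra ℂ G) N] [IsScalarTower ℂ (MonoidAlgebra ℂ G) N] (ρ : Representation ℂ G M)
    (ψ : ρ.asModule →ₗ[MonoidAlgebra ℂ G] N) (g : G) (x : ρ.asModule) :
    (ψ.restrictScalars ℂ) (ρ.asModuleEquiv.symm (ρ g (ρ.asModuleEquiv x))) = MonoidAlgebra.of ℂ G g • (ψ.restrictScalars ℂ) x := by
  rw [LinearMap.restrictScalars_apply, LinearMap.restrictScalars_apply, ← ψ.map_smul, of_smul_asModule ρ g]
  rfl

/-- in a `ℂ[G]`-module `N` with compatible `ℂ`-structure, `Representation.ofModule' N g y = of g • y`. [folklore] -/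
theorem ofModule'_apply_apply {N : Type*} [AddCommGroup N] [Module ℂ N] [Module (MonoidAlgebra ℂ G) N]
    [IsScalarTower ℂ (MonoidAlgebra ℂ G) N] (g : G) (y : N) :
    Representation.ofModule' (k := ℂ) (G := G) N g y = MonoidAlgebra.of ℂ G g • y := by
  rw [MonoidAlgebra.of_apply]
  rfl

variable {L : CMField}
variable {n : ℕ} (e : Fin 3 × Fin 1 ≃ Fin n)
  (JV : Matrix (Fin 3) (Fin 3) (L : Type)) (JW : Matrix (Fin 1) (Fin 1) (L : Type))
  {TV : Matrix (Fin 3) (Fin 3) ↥(maximalRealSubfield (L : Type))} {TW : Matrix (Fin 1) (Fin 1) ↥(maximalRealSubfield (L : Type))}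
  {δ : (L : Type)} (hcδ : IsCMField.complexConj (L : Type) δ = -δ) (hδ : δ ≠ 0) {d : ↥(maximalRealSubfield (L : Type))}
  (hd : δ * δ = algebraMap _ (L : Type) d) (hV : TV.IsSymm) (hW : TW.IsSymm) (hVd : IsUnit TV.det) (hWd : IsUnit TW.det)
  (hJV : JV = TV.map (algebraMap _ (L : Type))) (hJW : JW = TW.map (algebraMap _ (L : Type)))
  {s : UnitaryGroup.adelicPair (↥(maximalRealSubfield (L : Type))) (L : Type) (IsCMField.complexConj (L : Type)) 3 1 JV JW →*
    adelicMpCont (↥(maximalRealSubfield (L : Type))) (Fin n) (adelicGram (↥(maximalRealSubfield (L : Type))) e TV TW)}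

/-- **the dichotomy, `ℂ[G]`-module form**: if `ω_f ∘ s_pair` is NOT smooth (for `G` through a continuous `ι`, and `U(J_W)(𝔸_f)`),
then for every `χ` with open kernel and every SMOOTH `ℂ[G]`-module `N` (each vector fixed by an open subgroup), every `ℂ[G]`-linear
map `(weilCoinv χ hs ∘ ι).asModule → N` is `0` (`WeilCoinv.linearMap_eq_zero_of_not_smooth_comp` at the representation
`g ↦ (of g • ·)` of `G` on `N`, the `ℂ[G]`-linearity read as the intertwining through `Representation.asModuleEquiv_map_smul` ∕
`asAlgebraHom_of`).  Stated over a CM field `L ∕ L⁺` at ranks `(3, 1)` — the cell's case.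
[cite: GelbartRogawski1991, §3.1 Prop. 3.1.1 p. 455 L1–3, Remark p. 457 L4–13] [cite: BernsteinZelevinsky1976, §2.1] -/
theorem linearMap_asModule_eq_zero_of_not_smooth_comp [TopologicalSpace G]
    (ι : G →* ↥(UnitaryGroup.finAdelic (↥(maximalRealSubfield (L : Type))) (L : Type) (IsCMField.complexConj (L : Type)) 3 JV))
    (hι : Continuous ι)
    (hGR : (splittingDatum (↥(maximalRealSubfield (L : Type))) (L : Type) (IsCMField.complexConj (L : Type)) 3 1 e JV JW
      hcδ hδ hd hV hW hVd hWd hJV hJW).CompatibleSplitting)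
    (hs : (splittingDatum (↥(maximalRealSubfield (L : Type))) (L : Type) (IsCMField.complexConj (L : Type)) 3 1 e JV JW
      hcδ hδ hd hV hW hVd hWd hJV hJW).IsCompatible s)
    (hns : ¬ ((∀ v : FinSB (↥(maximalRealSubfield (L : Type))) (Fin 3 × Fin 1), ∃ K : Subgroup G, IsOpen (K : Set G) ∧ ∀ g ∈ K,
                    UnitaryDualPair.WeilCoinv.finPairRepV (↥(maximalRealSubfield (L : Type))) (L : Type)
                      (IsCMField.complexConj (L : Type)) 3 1 e JV JW hcδ hδ hd hV hW hVd hWd hJV hJW hs (ι g) v = v) ∧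
              ∀ v : FinSB (↥(maximalRealSubfield (L : Type))) (Fin 3 × Fin 1),
                ∃ K : Subgroup _, IsOpen (SetLike.coe K) ∧ ∀ u ∈ K,
                    UnitaryDualPair.WeilCoinv.finPairRepW (↥(maximalRealSubfield (L : Type))) (L : Type)
                      (IsCMField.complexConj (L : Type)) 3 1 e JV JW hcδ hδ hd hV hW hVd hWd hJV hJW hs u v = v))
    {χ : ↥(UnitaryGroup.finAdelic (↥(maximalRealSubfield (L : Type))) (L : Type) (IsCMField.complexConj (L : Type)) 1 JW) →* ℂˣ}
    (hχ : IsOpen (SetLike.coe χ.ker))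
    {N : Type*} {_i₁ : AddCommGroup N} {_i₂ : Module ℂ N} {_i₃ : Module (MonoidAlgebra ℂ G) N}
    {_i₄ : IsScalarTower ℂ (MonoidAlgebra ℂ G) N}
    (hN : ∀ y : N, ∃ K : Subgroup G, IsOpen (K : Set G) ∧ ∀ g ∈ K, MonoidAlgebra.of ℂ G g • y = y)
    (ψ : Representation.asModule
        ((UnitaryDualPair.WeilCoinv.weilCoinv (↥(maximalRealSubfield (L : Type))) (L : Type) (IsCMField.complexConj (L : Type))
          3 1 e JV JW hcδ hδ hd hV hW hVd hWd hJV hJW χ hs).comp ι) →ₗ[MonoidAlgebra ℂ G] N) :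
    ψ = 0 := by
  -- the `G`-action on `N` as the representation `Representation.ofModule' N : g ↦ (of g • ·)`
  have h0 := UnitaryDualPair.WeilCoinv.linearMap_eq_zero_of_not_smooth_comp (↥(maximalRealSubfield (L : Type))) (L : Type)
    (IsCMField.complexConj (L : Type)) 3 1 e JV JW hcδ hδ hd hV hW hVd hWd hJV hJW ι hι hGR hs hns hχ
    (Representation.ofModule' (k := ℂ) (G := G) N) (fun y => by simpa only [ofModule'_apply_apply] using hN y)
    (ψ.restrictScalars ℂ ∘ₗ
      (Representation.asModuleEquiv
        ((UnitaryDualPair.WeilCoinv.weilCoinv (↥(maximalRealSubfield (L : Type))) (L : Type) (IsCMField.complexConj (L : Type))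
          3 1 e JV JW hcδ hδ hd hV hW hVd hWd hJV hJW χ hs).comp ι)).symm.toLinearMap)
    fun g x => by
      rw [ofModule'_apply_apply]
      simpa only [LinearMap.comp_apply, LinearEquiv.coe_toLinearMap, MonoidHom.comp_apply, LinearEquiv.apply_symm_apply] using
        restrictScalars_apply_rho _ ψ g ((Representation.asModuleEquiv
          ((UnitaryDualPair.WeilCoinv.weilCoinv (↥(maximalRealSubfield (L : Type))) (L : Type)
            (IsCMField.complexConj (L : Type)) 3 1 e JV JW hcδ hδ hd hV hW hVd hWd hJV hJW χ hs).comp ι)).symm x)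
  refine LinearMap.ext fun x => ?_
  have hx := LinearMap.congr_fun h0
    (Representation.asModuleEquiv
      ((UnitaryDualPair.WeilCoinv.weilCoinv (↥(maximalRealSubfield (L : Type))) (L : Type) (IsCMField.complexConj (L : Type))
        3 1 e JV JW hcδ hδ hd hV hW hVd hWd hJV hJW χ hs).comp ι) x)
  simpa only [LinearMap.comp_apply, LinearEquiv.coe_toLinearMap, LinearEquiv.symm_apply_apply, LinearMap.restrictScalars_apply,
    LinearMap.zero_apply] using hx

end AsModule


/-! ### §3. Liu dictionaries whose oscillator modules are (quotients of) Weil-coinvariant modules: `block = ⊥` at the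
non-smooth lines; `Thm418C` from the smooth lines -/

section Dictionary

variable {L : CMField}
variable {n : ℕ} (e : Fin 3 × Fin 1 ≃ Fin n)
  (JV : Matrix (Fin 3) (Fin 3) (L : Type)) (JW : Matrix (Fin 1) (Fin 1) (L : Type))
  {TV : Matrix (Fin 3) (Fin 3) ↥(maximalRealSubfield (L : Type))} {TW : Matrix (Fin 1) (Fin 1) ↥(maximalRealSubfield (L : Type))}
  {δ : (L : Type)} (hcδ : IsCMField.complexConj (L : Type) δ = -δ) (hδ : δ ≠ 0) {d : ↥(maximalRealSubfield (L : Type))}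
  (hd : δ * δ = algebraMap _ (L : Type) d) (hV : TV.IsSymm) (hW : TW.IsSymm) (hVd : IsUnit TV.det) (hWd : IsUnit TW.det)
  (hJV : JV = TV.map (algebraMap _ (L : Type))) (hJW : JW = TW.map (algebraMap _ (L : Type)))
  {s : UnitaryGroup.adelicPair (↥(maximalRealSubfield (L : Type))) (L : Type) (IsCMField.complexConj (L : Type)) 3 1 JV JW →*
    adelicMpCont (↥(maximalRealSubfield (L : Type))) (Fin n) (adelicGram (↥(maximalRealSubfield (L : Type))) e TV TW)}

/-- **`block μ = ⊥` for a Liu–Albanese module datum over `G` with SMOOTH `H` whose oscillator modules `ω(μ, a)` are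
`ℂ[G]`-linear QUOTIENTS of the Weil-coinvariant modules `(weilCoinv (χ a) hs ∘ ι).asModule` of ONE compatible splitting `s`
with NON-smooth `ω_f ∘ s_pair`** (characters `χ a` with open kernel, `ι` continuous, [GR91, Prop. 3.1.1] granted at the datum):
every `ℂ[G]`-linear `ω(μ, a) → H` pulls back to a map out of the Weil module, which is `0` by §2.
[cite: GelbartRogawski1991, §3.1 Prop. 3.1.1 p. 455 L1–3, Remark p. 457 L4–13] [cite: BernsteinZelevinsky1976, §2.1] -/
theorem block_eq_bot_of_not_smooth {G : Type} [Group G] [TopologicalSpace G] {Lvl : Type} {Kof : Lvl → Subgroup G}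
    (D : LiuAlbaneseModuleDatum G Kof)
    (ι : G →* ↥(UnitaryGroup.finAdelic (↥(maximalRealSubfield (L : Type))) (L : Type) (IsCMField.complexConj (L : Type)) 3 JV))
    (hι : Continuous ι)
    (hGR : (splittingDatum (↥(maximalRealSubfield (L : Type))) (L : Type) (IsCMField.complexConj (L : Type)) 3 1 e JV JW
      hcδ hδ hd hV hW hVd hWd hJV hJW).CompatibleSplitting)
    (hs : (splittingDatum (↥(maximalRealSubfield (L : Type))) (L : Type) (IsCMField.complexConj (L : Type)) 3 1 e JV JW
      hcδ hδ hd hV hW hVd hWd hJV hJW).IsCompatible s)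
    (hns : ¬ ((∀ v : FinSB (↥(maximalRealSubfield (L : Type))) (Fin 3 × Fin 1), ∃ K : Subgroup G, IsOpen (K : Set G) ∧ ∀ g ∈ K,
                    UnitaryDualPair.WeilCoinv.finPairRepV (↥(maximalRealSubfield (L : Type))) (L : Type)
                      (IsCMField.complexConj (L : Type)) 3 1 e JV JW hcδ hδ hd hV hW hVd hWd hJV hJW hs (ι g) v = v) ∧
              ∀ v : FinSB (↥(maximalRealSubfield (L : Type))) (Fin 3 × Fin 1),
                ∃ K : Subgroup _, IsOpen (SetLike.coe K) ∧ ∀ u ∈ K,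
                    UnitaryDualPair.WeilCoinv.finPairRepW (↥(maximalRealSubfield (L : Type))) (L : Type)
                      (IsCMField.complexConj (L : Type)) 3 1 e JV JW hcδ hδ hd hV hW hVd hWd hJV hJW hs u v = v))
    (hH : ∀ y : D.H, ∃ K : Subgroup G, IsOpen (K : Set G) ∧ ∀ g ∈ K, MonoidAlgebra.of ℂ G g • y = y)
    {μ : D.Char}
    (χof : D.Adm μ →
      (↥(UnitaryGroup.finAdelic (↥(maximalRealSubfield (L : Type))) (L : Type) (IsCMField.complexConj (L : Type)) 1 JW) →* ℂˣ))
    (hχ : ∀ a : D.Adm μ, IsOpen (SetLike.coe (χof a).ker))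
    (eΩ : ∀ a : D.Adm μ, Representation.asModule
        ((UnitaryDualPair.WeilCoinv.weilCoinv (↥(maximalRealSubfield (L : Type))) (L : Type) (IsCMField.complexConj (L : Type))
          3 1 e JV JW hcδ hδ hd hV hW hVd hWd hJV hJW (χof a) hs).comp ι) →ₗ[MonoidAlgebra ℂ G] D.Ω μ a)
    (heΩ : ∀ a : D.Adm μ, Function.Surjective (eΩ a)) :
    D.block μ = ⊥ :=
  block_eq_bot fun a ψ => by
    have h0 := linearMap_asModule_eq_zero_of_not_smooth_comp e JV JW hcδ hδ hd hV hW hVd hWd hJV hJW ι hι hGR hs hns (hχ a)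
      (_i₁ := D.instH₁) (_i₂ := D.instH₂) (_i₃ := D.instH₃) (_i₄ := D.instH₄) hH (ψ ∘ₗ eΩ a)
    refine LinearMap.ext fun x => ?_
    obtain ⟨y, rfl⟩ := heΩ a x
    simpa only [LinearMap.comp_apply, LinearMap.zero_apply] using LinearMap.congr_fun h0 y

variable {ι₁ : (L : Type) →+* ℂ} {V : HermSpace3 L ι₁}

/-- **The reading r8 `Thm418C` of a Liu dictionary with SMOOTH `H` whose oscillator modules are `ℂ[U(V)(𝔸_f)]`-linear quotients
of the Weil-coinvariant modules of a family of split lines `line : T.Char → SplitLine JV TV …` (through a continuous pullback hom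
`ιV`, at characters with open kernel) FOLLOWS from its clause at the characters whose line has SMOOTH finite Weil representation**
(both members, the `U(V)`-member through `ιV`), [GR91, Prop. 3.1.1] being granted at every line's datum: at the other characters
`block = ⊥` (`block_eq_bot_of_not_smooth`) and the clause is vacuous (§0).
[cite: Liu2021, Thm. 4.18 (FJcycle.tex l. 2232–2245)] [cite: GelbartRogawski1991, §3.1 Prop. 3.1.1 p. 455 L1–3, Remark p. 457 L4–13]
[cite: BernsteinZelevinsky1976, §2.1] -/
theorem thm418C_of_smooth {hHD : exists_isReal_hodgeModel} {hI : hodgePQ_independent_of_hodgeModel}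
    {h₁ : BallQuotientUniformised} {h₃ : CMAbelianVarietyRealised} (T : LiuDictionary hHD hI h₁ h₃ V)
    {TV' : Matrix (Fin 3) (Fin 3) ↥(maximalRealSubfield (L : Type))} {hV' : TV'.IsSymm} {hVd' : IsUnit TV'.det}
    {JV' : Matrix (Fin 3) (Fin 3) (L : Type)} {hJV' : JV' = TV'.map (algebraMap _ (L : Type))}
    (ιV : ↥V.adelicFin →*
      ↥(UnitaryGroup.finAdelic (↥(maximalRealSubfield (L : Type))) (L : Type) (IsCMField.complexConj (L : Type)) 3 JV'))
    (hι : Continuous ιV) (line : T.Char → SplitLine JV' TV' hcδ hδ hd hV' hVd' hJV')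
    (hGR : ∀ μ : T.Char, (splittingDatum (↥(maximalRealSubfield (L : Type))) (L : Type) (IsCMField.complexConj (L : Type)) 3 1
      (line μ).e JV' (line μ).JW hcδ hδ hd hV' (line μ).hW hVd' (line μ).hWd hJV' (line μ).hJW).CompatibleSplitting)
    (hH : ∀ y : T.H, ∃ K : Subgroup ↥V.adelicFin, IsOpen (K : Set ↥V.adelicFin) ∧ ∀ g ∈ K,
      MonoidAlgebra.of ℂ ↥V.adelicFin g • y = y)
    (χof : (μ : T.Char) → T.Adm μ → (line μ).CharW)
    (hχ : ∀ (μ : T.Char) (a : T.Adm μ), IsOpen (SetLike.coe (χof μ a).ker))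
    (eΩ : ∀ (μ : T.Char) (a : T.Adm μ), Representation.asModule
        ((UnitaryDualPair.WeilCoinv.weilCoinv (↥(maximalRealSubfield (L : Type))) (L : Type) (IsCMField.complexConj (L : Type))
          3 1 (line μ).e JV' (line μ).JW hcδ hδ hd hV' (line μ).hW hVd' (line μ).hWd hJV' (line μ).hJW (χof μ a)
          (line μ).hs).comp ιV) →ₗ[MonoidAlgebra ℂ ↥V.adelicFin] T.Ω μ a)
    (heΩ : ∀ (μ : T.Char) (a : T.Adm μ), Function.Surjective (eΩ μ a))
    (h : ∀ μ : T.Char, T.PhiMu μ →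
      ((∀ v : FinSB (↥(maximalRealSubfield (L : Type))) (Fin 3 × Fin 1), ∃ K : Subgroup ↥V.adelicFin,
          IsOpen (K : Set ↥V.adelicFin) ∧ ∀ g ∈ K,
            UnitaryDualPair.WeilCoinv.finPairRepV (↥(maximalRealSubfield (L : Type))) (L : Type)
              (IsCMField.complexConj (L : Type)) 3 1 (line μ).e JV' (line μ).JW hcδ hδ hd hV' (line μ).hW hVd' (line μ).hWd hJV'
              (line μ).hJW (line μ).hs (ιV g) v = v) ∧
        ∀ v : FinSB (↥(maximalRealSubfield (L : Type))) (Fin 3 × Fin 1),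
          ∃ K : Subgroup _, IsOpen (SetLike.coe K) ∧ ∀ u ∈ K,
              UnitaryDualPair.WeilCoinv.finPairRepW (↥(maximalRealSubfield (L : Type))) (L : Type)
                (IsCMField.complexConj (L : Type)) 3 1 (line μ).e JV' (line μ).JW hcδ hδ hd hV' (line μ).hW hVd' (line μ).hWd hJV'
                (line μ).hJW (line μ).hs u v = v) →
      ∃ Γ₀ : Level V, ∀ Γ ≤ Γ₀, ∀ x ∈ T.block μ, x ∈ fixedBy Γ.K T.H → T.res Γ x ∈ Submodule.span ℂ (T.cmClasses Γ μ)) :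
    T.Thm418C :=
  haveI : Nonempty (Level V) := ⟨Level.three V⟩
  thm418Combined_of_ne_bot _ _ fun μ hΦ hne =>
    h μ hΦ (Classical.not_not.1 fun hsm => hne
      (block_eq_bot_of_not_smooth (line μ).e JV' (line μ).JW hcδ hδ hd hV' (line μ).hW hVd' (line μ).hWd hJV' (line μ).hJW
        T.toLiuAlbaneseModuleDatum ιV hι (hGR μ) (line μ).hs hsm hH (χof μ) (hχ μ) (eΩ μ) (heΩ μ)))

end Dictionary

section TowerDictionary

variable {L : CMField} {ι₁ : (L : Type) →+* ℂ} (V : HermSpace3 L ι₁)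
variable {JV : Matrix (Fin 3) (Fin 3) (L : Type)} {TV : Matrix (Fin 3) (Fin 3) ↥(maximalRealSubfield (L : Type))}
  {δ : (L : Type)} {hcδ : IsCMField.complexConj (L : Type) δ = -δ} {hδ : δ ≠ 0} {d : ↥(maximalRealSubfield (L : Type))}
  {hd : δ * δ = algebraMap _ (L : Type) d} {hV : TV.IsSymm} {hVd : IsUnit TV.det}
  {hJV : JV = TV.map (algebraMap _ (L : Type))}
variable (ιV : ↥V.adelicFin →*
    ↥(UnitaryGroup.finAdelic (↥(maximalRealSubfield (L : Type))) (L : Type) (IsCMField.complexConj (L : Type)) 3 JV))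
  (Char : Type) (Adm : Char → Type) (line : Char → SplitLine JV TV hcδ hδ hd hV hVd hJV)
  (χof : (i : Char) → Adm i → (line i).CharW) (PhiMu : Char → Prop) (adm : Char → LiuCMSide → Prop)

/-- **the carrier `H` of the tower dictionary is a SMOOTH `ℂ[U(V)(𝔸_f)]`-module** (§1 through
`TowerCarrier.of_smul_eq_act`; the scalar action named through the dictionary's own instance field). [folklore] -/
theorem ofTower_H_smooth (hHD : exists_isReal_hodgeModel) (hI : hodgePQ_independent_of_hodgeModel)
    (h₁ : BallQuotientUniformised) (h₃ : CMAbelianVarietyRealised) (hA : Arapura2012_Cor_15_4_6) :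
    ∀ y : (LiuDictionary.ofTower hHD hI h₁ h₃ hA V Char Adm (fun i a => (line i).Ω ιV (χof i a)) PhiMu adm).H,
      ∃ K : Subgroup ↥V.adelicFin, IsOpen (K : Set ↥V.adelicFin) ∧ ∀ g ∈ K,
        @HSMul.hSMul (MonoidAlgebra ℂ ↥V.adelicFin) _ _
          (@instHSMul _ _ (LiuDictionary.ofTower hHD hI h₁ h₃ hA V Char Adm (fun i a => (line i).Ω ιV (χof i a)) PhiMu
            adm).instH₃.toSMul)
          (MonoidAlgebra.of ℂ ↥V.adelicFin g) y = y := fun y => by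
  obtain ⟨K, hK, h⟩ := tower_smooth hHD hI (ballQuotientUniformisedDatum_of h₁) h₃ hA V y
  exact ⟨K, hK, fun g hg => (of_smul_eq_act hHD hI (ballQuotientUniformisedDatum_of h₁) h₃ hA g y).trans (h g hg)⟩

/-- **`block i = ⊥` at an index whose line has NON-smooth finite Weil representation, for the tower dictionary with
Weil-coinvariant oscillator modules** `LiuDictionary.ofTower … V Char Adm (fun i a => (line i).Ω ιV (χof i a)) PhiMu adm`
(characters `χof i a` with open kernel; `ιV` continuous; [GR91, Prop. 3.1.1] granted at the line's datum): §3 at the tower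
(smooth, §1) with `eΩ := id` (the split line's `Ω` IS the Literature Weil module, definitionally).
[cite: GelbartRogawski1991, §3.1 Prop. 3.1.1 p. 455 L1–3, Remark p. 457 L4–13] [cite: BernsteinZelevinsky1976, §2.1] -/
theorem block_ofTower_eq_bot_of_not_smooth (hHD : exists_isReal_hodgeModel) (hI : hodgePQ_independent_of_hodgeModel)
    (h₁ : BallQuotientUniformised) (h₃ : CMAbelianVarietyRealised) (hA : Arapura2012_Cor_15_4_6) (hι : Continuous ιV) (i : Char)
    (hGR : (splittingDatum (↥(maximalRealSubfield (L : Type))) (L : Type) (IsCMField.complexConj (L : Type)) 3 1 (line i).e JV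
      (line i).JW hcδ hδ hd hV (line i).hW hVd (line i).hWd hJV (line i).hJW).CompatibleSplitting)
    (hns : ¬ ((∀ v : FinSB (↥(maximalRealSubfield (L : Type))) (Fin 3 × Fin 1), ∃ K : Subgroup ↥V.adelicFin,
                  IsOpen (K : Set ↥V.adelicFin) ∧ ∀ g ∈ K,
                    UnitaryDualPair.WeilCoinv.finPairRepV (↥(maximalRealSubfield (L : Type))) (L : Type)
                      (IsCMField.complexConj (L : Type)) 3 1 (line i).e JV (line i).JW hcδ hδ hd hV (line i).hW hVd (line i).hWd hJV
                      (line i).hJW (line i).hs (ιV g) v = v) ∧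
              ∀ v : FinSB (↥(maximalRealSubfield (L : Type))) (Fin 3 × Fin 1),
                ∃ K : Subgroup _, IsOpen (SetLike.coe K) ∧ ∀ u ∈ K,
                    UnitaryDualPair.WeilCoinv.finPairRepW (↥(maximalRealSubfield (L : Type))) (L : Type)
                      (IsCMField.complexConj (L : Type)) 3 1 (line i).e JV (line i).JW hcδ hδ hd hV (line i).hW hVd (line i).hWd hJV
                      (line i).hJW (line i).hs u v = v))
    (hχ : ∀ a : Adm i, IsOpen (SetLike.coe (χof i a).ker)) :
    (LiuDictionary.ofTower hHD hI h₁ h₃ hA V Char Adm (fun i a => (line i).Ω ιV (χof i a)) PhiMu adm).block i = ⊥ :=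
  block_eq_bot_of_not_smooth (line i).e JV (line i).JW hcδ hδ hd hV (line i).hW hVd (line i).hWd hJV (line i).hJW
    (LiuDictionary.ofTower hHD hI h₁ h₃ hA V Char Adm (fun i a => (line i).Ω ιV (χof i a)) PhiMu adm).toLiuAlbaneseModuleDatum
    ιV hι hGR (line i).hs hns
    (ofTower_H_smooth V ιV Char Adm line χof PhiMu adm hHD hI h₁ h₃ hA)
    (χof i) hχ (fun _ => LinearMap.id) fun _ => Function.surjective_id

/-- **The reading r8 `Thm418C` of the tower dictionary with Weil-coinvariant oscillator modules FOLLOWS from its clause at the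
indices whose line has SMOOTH finite Weil representation** (both members, the `U(V)`-member through the continuous `ιV`),
[GR91, Prop. 3.1.1] being granted at every line's datum: at the other indices `block = ⊥` and the clause is vacuous.
[cite: Liu2021, Thm. 4.18 (FJcycle.tex l. 2232–2245)] [cite: GelbartRogawski1991, §3.1 Prop. 3.1.1 p. 455 L1–3, Remark p. 457 L4–13]
[cite: BernsteinZelevinsky1976, §2.1] -/
theorem thm418C_ofTower_of_smooth (hHD : exists_isReal_hodgeModel) (hI : hodgePQ_independent_of_hodgeModel)
    (h₁ : BallQuotientUniformised) (h₃ : CMAbelianVarietyRealised) (hA : Arapura2012_Cor_15_4_6)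
    (hι : Continuous ιV)
    (hGR : ∀ i : Char, (splittingDatum (↥(maximalRealSubfield (L : Type))) (L : Type) (IsCMField.complexConj (L : Type)) 3 1
      (line i).e JV (line i).JW hcδ hδ hd hV (line i).hW hVd (line i).hWd hJV (line i).hJW).CompatibleSplitting)
    (hχ : ∀ (i : Char) (a : Adm i), IsOpen (SetLike.coe (χof i a).ker))
    (h : ∀ i : Char, PhiMu i →
      ((∀ v : FinSB (↥(maximalRealSubfield (L : Type))) (Fin 3 × Fin 1), ∃ K : Subgroup ↥V.adelicFin,
          IsOpen (K : Set ↥V.adelicFin) ∧ ∀ g ∈ K,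
            UnitaryDualPair.WeilCoinv.finPairRepV (↥(maximalRealSubfield (L : Type))) (L : Type)
              (IsCMField.complexConj (L : Type)) 3 1 (line i).e JV (line i).JW hcδ hδ hd hV (line i).hW hVd (line i).hWd hJV
              (line i).hJW (line i).hs (ιV g) v = v) ∧
        ∀ v : FinSB (↥(maximalRealSubfield (L : Type))) (Fin 3 × Fin 1),
          ∃ K : Subgroup _, IsOpen (SetLike.coe K) ∧ ∀ u ∈ K,
              UnitaryDualPair.WeilCoinv.finPairRepW (↥(maximalRealSubfield (L : Type))) (L : Type)
                (IsCMField.complexConj (L : Type)) 3 1 (line i).e JV (line i).JW hcδ hδ hd hV (line i).hW hVd (line i).hWd hJV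
                (line i).hJW (line i).hs u v = v) →
      ∃ Γ₀ : Level V, ∀ Γ ≤ Γ₀,
        ∀ x ∈ (LiuDictionary.ofTower hHD hI h₁ h₃ hA V Char Adm (fun i a => (line i).Ω ιV (χof i a)) PhiMu adm).block i,
          x ∈ fixedBy Γ.K (LiuDictionary.ofTower hHD hI h₁ h₃ hA V Char Adm (fun i a => (line i).Ω ιV (χof i a)) PhiMu adm).H →
            (LiuDictionary.ofTower hHD hI h₁ h₃ hA V Char Adm (fun i a => (line i).Ω ιV (χof i a)) PhiMu adm).res Γ x ∈
              Submodule.span ℂ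
                ((LiuDictionary.ofTower hHD hI h₁ h₃ hA V Char Adm (fun i a => (line i).Ω ιV (χof i a)) PhiMu adm).cmClasses
                  Γ i)) :
    (LiuDictionary.ofTower hHD hI h₁ h₃ hA V Char Adm (fun i a => (line i).Ω ιV (χof i a)) PhiMu adm).Thm418C :=
  thm418C_of_smooth hcδ hδ hd
    (LiuDictionary.ofTower hHD hI h₁ h₃ hA V Char Adm (fun i a => (line i).Ω ιV (χof i a)) PhiMu adm) ιV hι line hGR
    (ofTower_H_smooth V ιV Char Adm line χof PhiMu adm hHD hI h₁ h₃ hA)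
    χof hχ (fun _ _ => LinearMap.id) (fun _ _ => Function.surjective_id) h

end TowerDictionary

end Summit.HodgeConjecture.CorCM.Transposition.BlockVanishing

end
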